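import Summits.HubbardSuperconductivity.HubbardSuperconductivity.Theorems.WindowInfraredBound.Negative.PairedDickeStates
import Summits.HubbardSuperconductivity.HubbardSuperconductivity.Theorems.WindowInfraredBound.Negative.TwistedDWaveWeight
import Literature.MathematicalPhysics.QuantumLattice.MagneticHubbardTorusGauge

/-!
# Crux `WindowInfraredBound` (item `stmt-HubbardSuperconductivity-1089`): the ground-state hypothesis
# is load-bearing — the window bound FAILS over all normalised sector states

`not_windowBoundAllSectorStates` settles the near-miss §5 of the standing disprover's work file
(`Cruxes/WindowInfraredBound/Disproof.lean`): replace `IsGroundStateInSector (hubbardTorus 2 L 1 U) N_L 0 ψ`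
in the crux by mere membership `ψ ∈ szSector N_L 0` and the statement is FALSE.  Hence any proof of the
crux must use the ground-state property (through the energy), not sector bookkeeping, normalisation or the
momentum cut alone (those are load-bearing too: `…/Negative/LoadBearing.lean`, `…/ParsevalCeiling.lean`).

WITNESS (momentum space; no Jordan–Wigner sign enters).  On the torus of side `L = 12t` take the DICKE
CONDENSATE of `n = 3t²` zero-momentum `d`-wave-bright pairs `b†_k = c†_{k↑}c†_{−k↓}` over a box `K'` of
`6t²` Bloch momenta with `cos p₂(k) ≥ 1/2` and `cos p₁(k)` of a fixed sign, on top of an inert block of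
`51t²` filled pairs (so `N = 2·54t² = 2⌊(1-δ)L²/2⌋` at `δ = 1/4`), and BOOST it with the Lieb–Schultz–Mattis
twist `G = phaseGauge (twistGauge L (−2π))`: by the landed covariance
`Gᴴ Δ_{f·1_e}(m) G = conj χ_{jê₁}(e) • Δ_{f·1_e}(m + 2jê₁)` (`KacWindowPenaltyWindowGapTwistedPairField`) the
`d`-wave pair field at the WINDOW momentum `m₀ = 2ê₁` (`|q_{m₀}| = 4π/L`) acts on `G ψ₀` as `G B_W ψ₀` with the
zero-momentum weighted pair annihilator `B_W = Σ_k W_k b_k`, `Re W_k = 2√2 (cos p₂ − ρ cos p₁) ≥ √2` on `K'`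
(`ρ = Re conj χ_{−ê₁}(ê₁)`, whose value is never needed: the sign of `cos p₁` on the box is chosen against it).
The Dicke enhancement of `…/Negative/PairedDickeStates.lean` then gives
`S_ψ(m₀) = ‖Δ_d(m₀)ψ‖²/L² ≥ 2n(6t² − n + 1)/L² ≥ t²/8`, i.e. `Θ(L²)` pair weight at the smallest window
momenta, while the bound allows only `CεL² = 144Cεt²` — contradiction for `ε < 1/(1152(C+1))` and `L ≥ 4π/ε`.

Contents: `exists_sector_state_large_pairStructureFactor` (the witness) and
`not_windowBoundAllSectorStates` (the refutation of the mutated crux); the twisted weight `W`, its profile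
and the momentum boxes are in `…/Negative/TwistedDWaveWeight.lean`, the Dicke bookkeeping (orthonormal paired
vectors, `⟨Ψ,Ψ⟩ = C(M,n)`, sector, Bessel lower bound) in `…/Negative/PairedDickeStates.lean`.  Physically: `Θ(L²)` pairs
condensed at total momentum `4π/L` cost extensive kinetic energy — the crux is a statement about the bottom of
the spectrum, not about the sector.  Sources: R. H. Dicke, Phys. Rev. 93 (1954) 99; C. N. Yang,
Rev. Mod. Phys. 34 (1962) 694, §5; H. Watanabe, J. Stat. Phys. 177 (2019) 717, §2.2.1 (twist operator);
D. J. Scalapino, Phys. Rep. 250 (1995) 329, §2.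
-/

-- the mandated namespace `Summit.<Summit>.<Problem>.Theorems` repeats `HubbardSuperconductivity`
-- (single-problem summit, D-0017), which the `dupNamespace` linter flags on every declaration
set_option linter.dupNamespace false

noncomputable section

namespace Summit.HubbardSuperconductivity.HubbardSuperconductivity.Theorems.WindowInfraredBound.Negative

open Literature.MathematicalPhysics.QuantumLattice Literature.Probability.LatticeModels Matrix Finset
open scoped ComplexOrder ComplexConjugate

section Witness

variable {L : ℕ} [NeZero L]

/-! ### The witness: a twisted Dicke condensate in the sector `(2·54t², 0)` of the torus of side `12t` -/

/-- **The witness.** On the torus of side `L = 12t` (`t ≥ 1`) there is a normalised vector of the joint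
sector `(N, S^z) = (2·54t², 0)` whose `d`-wave pair structure factor at the window momentum `m₀ = 2ê₁`
(`|q_{m₀}| = 4π/L`) is at least `t²/8 = L²/1152`: the Lieb–Schultz–Mattis twist (winding `−1`) of the
normalised Dicke condensate of `3t²` zero-momentum pairs over a box of `6t²` `d`-wave-bright momenta on top
of an inert block of `51t²` filled pairs.  Dicke, Phys. Rev. 93 (1954) 99; Yang, Rev. Mod. Phys. 34
(1962) 694, §5; Watanabe, J. Stat. Phys. 177 (2019) 717, §2.2.1. [folklore] -/
theorem exists_sector_state_large_pairStructureFactor {t : ℕ} (ht : 1 ≤ t) (hL : L = 12 * t) :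
    ∃ ψ : Fock (Orb (FermionTorus 2 L)), star ψ ⬝ᵥ ψ = 1 ∧
      ψ ∈ szSector (Λ := FermionTorus 2 L) (2 * (54 * t ^ 2)) 0 ∧
      (t : ℝ) ^ 2 / 8 ≤ pairStructureFactor dWaveFormFactor L ψ
        (-(Pi.single 0 (((2 * (-1 : ℤ) : ℤ)) : ZMod L))) := by
  classical
  -- the box is chosen against the sign of the twist phase `ρ` seen by a horizontal bond
  have hK : ∃ K : Finset (TorusSite 2 L), 6 * t ^ 2 ≤ K.card ∧ ∀ k ∈ K,
      (conj (torusChar (Pi.single 0 ((-1 : ℤ) : ZMod L) : TorusSite 2 L)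
          (Torus.proj L (Pi.single 0 1)))).re * Real.cos (latticeMomentum L k 0) ≤ 0 ∧
        1 / 2 ≤ Real.cos (latticeMomentum L k 1) := by
    by_cases hρ0 : 0 ≤ (conj (torusChar (Pi.single 0 ((-1 : ℤ) : ZMod L) : TorusSite 2 L)
        (Torus.proj L (Pi.single 0 1)))).re
    · refine ⟨((Finset.range (3 * t + 1) ×ˢ Finset.range (2 * t + 1)).image
        (fun p : ℕ × ℕ => (![((3 * t + p.1 : ℕ) : ZMod L), ((p.2 : ℕ) : ZMod L)] : TorusSite 2 L))),
        le_card_box (3 * t) t (by omega) (by omega), fun k hk => ?_⟩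
      obtain ⟨h2, -, h1⟩ := cos_box ht hL (Or.inr rfl) hk
      exact ⟨mul_nonpos_of_nonneg_of_nonpos hρ0 (h1 rfl), h2⟩
    · refine ⟨((Finset.range (3 * t + 1) ×ˢ Finset.range (2 * t + 1)).image
        (fun p : ℕ × ℕ => (![((0 + p.1 : ℕ) : ZMod L), ((p.2 : ℕ) : ZMod L)] : TorusSite 2 L))),
        le_card_box 0 t (by omega) (by omega), fun k hk => ?_⟩
      obtain ⟨h2, h1, -⟩ := cos_box ht hL (Or.inl rfl) hk
      exact ⟨mul_nonpos_of_nonpos_of_nonneg (le_of_lt (not_le.1 hρ0)) (h1 rfl), h2⟩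
  obtain ⟨K, hKcard, hK⟩ := hK
  -- condensate modes `K' ⊆ K` (`|K'| = 6t²`) and an inert block `F` (`|F| = 51t²`) off `K'`
  obtain ⟨K', hK'K, hK'card⟩ := Finset.exists_subset_card_eq hKcard
  have hcardU : (Finset.univ : Finset (TorusSite 2 L)).card = 144 * t ^ 2 := by
    rw [Finset.card_univ, Fintype.card_fun, Fintype.card_fin, ZMod.card, hL]
    ring
  have hcompl : 51 * t ^ 2 ≤ (Finset.univ \ K').card := by
    rw [Finset.card_sdiff_of_subset (Finset.subset_univ _), hcardU, hK'card]
    omega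
  obtain ⟨F, hF, hFcard⟩ := Finset.exists_subset_card_eq hcompl
  have hFK' : Disjoint F K' := Finset.disjoint_of_subset_left hF Finset.sdiff_disjoint
  have ht2 : 1 ≤ t ^ 2 := Nat.one_le_pow _ _ ht
  have hn1 : 1 ≤ 3 * t ^ 2 := by omega
  have hnK : 3 * t ^ 2 ≤ K'.card := by rw [hK'card]; omega
  -- the weight of the twisted pair field (opaque name `W`) and its profile on `K'`
  obtain ⟨W, hWdef⟩ : ∃ W : TorusSite 2 L → ℂ, W = fun k => -(∑ e ∈ insert (0 : Site 2) unitSteps,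
      conj (torusChar (Pi.single 0 ((-1 : ℤ) : ZMod L) : TorusSite 2 L) (Torus.proj L e)) *
        (pairFieldMode (Pi.single e (dWaveFormFactor e)) L k : ℂ)) := ⟨_, rfl⟩
  have hW : ∀ k ∈ K', Real.sqrt 2 ≤ (W k).re := by
    intro k hk
    rw [hWdef]
    dsimp only
    rw [re_twistWeight (-1) k]
    obtain ⟨h1, h2⟩ := hK k (hK'K hk)
    have hs : (0 : ℝ) ≤ 2 * Real.sqrt 2 := by positivity
    have ha := mul_le_mul_of_nonneg_left h2 hs
    have hb := mul_nonpos_of_nonneg_of_nonpos hs h1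
    linarith
  -- the weighted pair annihilator `B`, the Dicke condensate `ψ₀`, the twist
  obtain ⟨B, hBdef⟩ : ∃ B : Matrix (Finset (Orb (FermionTorus 2 L))) (Finset (Orb (FermionTorus 2 L))) ℂ,
      B = ∑ k : TorusSite 2 L, W k • pairMode k := ⟨_, rfl⟩
  obtain ⟨ψ₀, hψ₀def⟩ : ∃ ψ₀ : Fock (Orb (FermionTorus 2 L)), ψ₀ = ∑ S ∈ powersetCard (3 * t ^ 2) K',
      (List.map (fun k : TorusSite 2 L => (pairMode k)ᴴ) (F ∪ S).toList).prod *ᵥ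
        (vacuum : Fock (Orb (FermionTorus 2 L))) := ⟨_, rfl⟩
  have hGΔ : (phaseGauge fun u : FermionTorus 2 L => twistGauge L ((-1 : ℤ) * (2 * Real.pi)) u.toTorusSite)ᴴ *
      pairFieldAt dWaveFormFactor L (-(Pi.single 0 (((2 * (-1 : ℤ) : ℤ)) : ZMod L))) *
      phaseGauge (fun u : FermionTorus 2 L => twistGauge L ((-1 : ℤ) * (2 * Real.pi)) u.toTorusSite) = B := by
    rw [hBdef, hWdef]
    exact conjTranspose_twist_mul_pairFieldAt_dWave_mul (L := L) (-1)
  have hGu : ∀ v, (phaseGauge fun u : FermionTorus 2 L =>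
      twistGauge L ((-1 : ℤ) * (2 * Real.pi)) u.toTorusSite)ᴴ *ᵥ
        (phaseGauge (fun u : FermionTorus 2 L => twistGauge L ((-1 : ℤ) * (2 * Real.pi)) u.toTorusSite) *ᵥ v) =
          v :=
    conjTranspose_phaseGauge_mulVec_phaseGauge_mulVec _
  -- Dicke facts
  have hψ₀norm : star ψ₀ ⬝ᵥ ψ₀ = (((6 * t ^ 2).choose (3 * t ^ 2) : ℕ) : ℂ) := by
    rw [hψ₀def, star_dicke_dotProduct_dicke hFK', hK'card]
  have hψ₀mem : ψ₀ ∈ szSector (Λ := FermionTorus 2 L) (2 * (54 * t ^ 2)) 0 := by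
    have h := dicke_mem_szSector (L := L) hFK' (3 * t ^ 2)
    rw [hFcard, show 51 * t ^ 2 + 3 * t ^ 2 = 54 * t ^ 2 by ring, ← hψ₀def] at h
    exact h
  have hD : (((6 * t ^ 2).choose (3 * t ^ 2 - 1) : ℕ) : ℝ) *
      (Real.sqrt 2 * (((6 * t ^ 2 : ℕ) : ℝ) - (3 * t ^ 2 : ℕ) + 1)) ^ 2 ≤
        (star (B *ᵥ ψ₀) ⬝ᵥ (B *ᵥ ψ₀)).re := by
    have h := dicke_weightedPairMode_lower_bound hFK' W hn1 hnK (Real.sqrt_nonneg 2) hW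
    rw [hK'card, ← hBdef, ← hψ₀def] at h
    exact_mod_cast h
  -- the binomial identity `C(6t², 3t²)·3t² = C(6t², 3t²−1)·(3t²+1)` and positivity
  have hchoose : (((6 * t ^ 2).choose (3 * t ^ 2) : ℕ) : ℝ) * (3 * (t : ℝ) ^ 2) =
      (((6 * t ^ 2).choose (3 * t ^ 2 - 1) : ℕ) : ℝ) * (3 * (t : ℝ) ^ 2 + 1) := by
    have h := Nat.choose_succ_right_eq (6 * t ^ 2) (3 * t ^ 2 - 1)
    rw [Nat.sub_add_cancel hn1, show 6 * t ^ 2 - (3 * t ^ 2 - 1) = 3 * t ^ 2 + 1 by omega] at h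
    exact_mod_cast h
  have hNpos : (0 : ℝ) < ((6 * t ^ 2).choose (3 * t ^ 2) : ℕ) := by
    exact_mod_cast Nat.choose_pos (by omega)
  -- the normalised, twisted condensate
  obtain ⟨c, hcdef⟩ : ∃ c : ℝ, c = (Real.sqrt (((6 * t ^ 2).choose (3 * t ^ 2) : ℕ) : ℝ))⁻¹ := ⟨_, rfl⟩
  have hc2 : c ^ 2 * (((6 * t ^ 2).choose (3 * t ^ 2) : ℕ) : ℝ) = 1 := by
    rw [hcdef, inv_pow, Real.sq_sqrt hNpos.le, inv_mul_cancel₀ hNpos.ne']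
  have hstar : star ((c : ℝ) : ℂ) = ((c : ℝ) : ℂ) := by simp
  refine ⟨phaseGauge (fun u : FermionTorus 2 L => twistGauge L ((-1 : ℤ) * (2 * Real.pi)) u.toTorusSite) *ᵥ
    (((c : ℝ) : ℂ) • ψ₀), ?_, ?_, ?_⟩
  · -- normalisation
    rw [star_mulVec_dotProduct_self_of_unitary hGu, star_smul, smul_dotProduct, dotProduct_smul, hψ₀norm,
      smul_eq_mul, smul_eq_mul, hstar]
    have : (c : ℂ) * ((c : ℂ) * (((6 * t ^ 2).choose (3 * t ^ 2) : ℕ) : ℂ)) = ((c ^ 2 *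
        (((6 * t ^ 2).choose (3 * t ^ 2) : ℕ) : ℝ) : ℝ) : ℂ) := by
      push_cast
      ring
    rw [this, hc2, Complex.ofReal_one]
  · -- sector
    exact phaseGauge_mulVec_mem_szSector _ (Submodule.smul_mem _ _ hψ₀mem)
  · -- the pair structure factor at `m₀`
    rw [pairStructureFactor_apply, mulVec_phaseGauge_mulVec, hGΔ, mulVec_smul,
      star_mulVec_dotProduct_self_of_unitary hGu, star_smul, smul_dotProduct, dotProduct_smul, smul_eq_mul,
      smul_eq_mul, hstar, ← mul_assoc, ← Complex.ofReal_mul, Complex.re_ofReal_mul]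
    have hLr : (L : ℝ) = 12 * t := by rw [hL]; push_cast; ring
    have hLsq : (0 : ℝ) < (L : ℝ) ^ 2 := by rw [hLr]; positivity
    rw [le_div_iff₀ hLsq, hLr]
    -- `c² · C(6t²,3t²-1) · (√2 (3t²+1))² = 2 · 3t² · (3t²+1)`
    have hsqrt2 : Real.sqrt 2 ^ 2 = 2 := Real.sq_sqrt zero_le_two
    have h3 : (((6 * t ^ 2 : ℕ) : ℝ) - (3 * t ^ 2 : ℕ) + 1) = 3 * (t : ℝ) ^ 2 + 1 := by
      push_cast; ring
    have hkey : c * c * ((((6 * t ^ 2).choose (3 * t ^ 2 - 1) : ℕ) : ℝ) *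
        (Real.sqrt 2 * (((6 * t ^ 2 : ℕ) : ℝ) - (3 * t ^ 2 : ℕ) + 1)) ^ 2) =
          2 * (3 * (t : ℝ) ^ 2) * (3 * (t : ℝ) ^ 2 + 1) := by
      rw [h3, mul_pow, hsqrt2]
      calc c * c * ((((6 * t ^ 2).choose (3 * t ^ 2 - 1) : ℕ) : ℝ) * (2 * (3 * (t : ℝ) ^ 2 + 1) ^ 2))
          = 2 * (3 * (t : ℝ) ^ 2 + 1) * (c ^ 2 * ((((6 * t ^ 2).choose (3 * t ^ 2 - 1) : ℕ) : ℝ) *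
              (3 * (t : ℝ) ^ 2 + 1))) := by ring
        _ = 2 * (3 * (t : ℝ) ^ 2 + 1) * (c ^ 2 * ((((6 * t ^ 2).choose (3 * t ^ 2) : ℕ) : ℝ) *
              (3 * (t : ℝ) ^ 2))) := by rw [hchoose]
        _ = 2 * (3 * (t : ℝ) ^ 2 + 1) * ((c ^ 2 * (((6 * t ^ 2).choose (3 * t ^ 2) : ℕ) : ℝ)) *
              (3 * (t : ℝ) ^ 2)) := by ring
        _ = 2 * (3 * (t : ℝ) ^ 2) * (3 * (t : ℝ) ^ 2 + 1) := by rw [hc2]; ring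
    have hcc : 0 ≤ c * c := mul_self_nonneg c
    calc (t : ℝ) ^ 2 / 8 * (12 * (t : ℝ)) ^ 2 = 18 * (t : ℝ) ^ 4 := by ring
      _ ≤ 2 * (3 * (t : ℝ) ^ 2) * (3 * (t : ℝ) ^ 2 + 1) := by nlinarith [sq_nonneg (t : ℝ)]
      _ = c * c * ((((6 * t ^ 2).choose (3 * t ^ 2 - 1) : ℕ) : ℝ) *
            (Real.sqrt 2 * (((6 * t ^ 2 : ℕ) : ℝ) - (3 * t ^ 2 : ℕ) + 1)) ^ 2) := hkey.symm
      _ ≤ c * c * (star (B *ᵥ ψ₀) ⬝ᵥ (B *ᵥ ψ₀)).re := mul_le_mul_of_nonneg_left hD hcc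

end Witness

/-! ### The refutation of the mutated crux -/

/-- **The ground-state hypothesis of `WindowInfraredBound` is load-bearing**: the crux with
`IsGroundStateInSector (hubbardTorus 2 L 1 U) N_L 0 ψ` weakened to `ψ ∈ szSector N_L 0` (the statement
`WindowBoundAllSectorStates` of `Cruxes/WindowInfraredBound/Disproof.lean` §5, inlined) is FALSE.
Given the purported `C, ε₀, L₀` at `(U, δ) = (1, 1/4)`, take `ε = min ε₀ (1/(1152(C+1)))` and the torus of
side `L = 12t ≥ max L₀ (4π/ε)`: the twisted Dicke condensate of
`exists_sector_state_large_pairStructureFactor` is a normalised vector of the sector `(2⌊(3/4)L²/2⌋, 0)`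
with `S_ψ(2ê₁) ≥ L²/1152` at the window momentum `|q| = 4π/L ≤ ε`, so `T_ε(ψ) ≥ L²/1152 > CεL²`.
Physically: `Θ(L²)` pairs condensed at the smallest window momenta — kinetically expensive, excluded only
by the energy.  Dicke, Phys. Rev. 93 (1954) 99; Yang, Rev. Mod. Phys. 34 (1962) 694, §5;
Watanabe, J. Stat. Phys. 177 (2019) 717, §2.2.1. [folklore] -/
theorem not_windowBoundAllSectorStates :
    ¬ (∀ U : ℝ, 0 < U → ∀ δ ∈ Set.Ioo (0:ℝ) (1 / 2), ∃ C ε₀ : ℝ, 0 ≤ C ∧ 0 < ε₀ ∧ ∃ L₀ : ℕ,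
        ∀ ε ∈ Set.Ioc (0:ℝ) ε₀, ∀ (L : ℕ) [NeZero L], L₀ ≤ L → Even L →
          ∀ ψ : Fock (Orb (FermionTorus 2 L)), star ψ ⬝ᵥ ψ = 1 →
            ψ ∈ szSector (Λ := FermionTorus 2 L) (2 * ⌊(1 - δ) * (L : ℝ) ^ 2 / 2⌋₊) 0 →
              (∑ m : TorusSite 2 L, if m ≠ 0 ∧ momentumNormSq L m ≤ ε ^ 2 then
                  pairStructureFactor dWaveFormFactor L ψ m else 0) ≤ C * ε * (L : ℝ) ^ 2) := by
  intro h
  obtain ⟨C, ε₀, hC, hε₀, L₀, hL⟩ := h 1 one_pos (1 / 4) ⟨by norm_num, by norm_num⟩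
  -- the window radius
  obtain ⟨ε, hεdef⟩ : ∃ ε : ℝ, ε = min ε₀ (1 / (1152 * (C + 1))) := ⟨_, rfl⟩
  have hεpos : 0 < ε := by rw [hεdef]; exact lt_min hε₀ (by positivity)
  have hεε₀ : ε ≤ ε₀ := by rw [hεdef]; exact min_le_left _ _
  have hεC : 1152 * (C + 1) * ε ≤ 1 := by
    have h1 : ε ≤ 1 / (1152 * (C + 1)) := by rw [hεdef]; exact min_le_right _ _
    rw [le_div_iff₀ (by positivity)] at h1
    linarith
  -- the torus side `L = 12 t`
  obtain ⟨t, htdef⟩ : ∃ t : ℕ, t = L₀ + ⌈4 * Real.pi / ε⌉₊ + 1 := ⟨_, rfl⟩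
  have ht : 1 ≤ t := by omega
  haveI : NeZero (12 * t) := ⟨by omega⟩
  have hL₀ : L₀ ≤ 12 * t := by omega
  have hEven : Even (12 * t) := ⟨6 * t, by ring⟩
  have htr : (4 * Real.pi / ε : ℝ) ≤ t := by
    have h1 := Nat.le_ceil (4 * Real.pi / ε)
    have h2 : ((⌈4 * Real.pi / ε⌉₊ : ℕ) : ℝ) ≤ t := by
      rw [htdef]; push_cast; linarith [show (0:ℝ) ≤ L₀ from Nat.cast_nonneg _]
    linarith
  have htpos : (0 : ℝ) < t := by exact_mod_cast ht
  -- the witness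
  obtain ⟨ψ, hψ1, hψmem, hψS⟩ :=
    exists_sector_state_large_pairStructureFactor (L := 12 * t) ht rfl
  have hfloor : 2 * ⌊(1 - 1 / 4) * (((12 * t : ℕ)) : ℝ) ^ 2 / 2⌋₊ = 2 * (54 * t ^ 2) := by
    have : (1 - 1 / 4) * (((12 * t : ℕ)) : ℝ) ^ 2 / 2 = ((54 * t ^ 2 : ℕ) : ℝ) := by
      push_cast; ring
    rw [this, Nat.floor_natCast]
  rw [← hfloor] at hψmem
  have hmain := hL ε ⟨hεpos, hεε₀⟩ (12 * t) hL₀ hEven ψ hψ1 hψmem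
  -- the window momentum `m₀ = 2ê₁`
  obtain ⟨m₀, hm₀⟩ : ∃ m₀ : TorusSite 2 (12 * t), m₀ = -(Pi.single 0 (((2 * (-1 : ℤ) : ℤ)) : ZMod (12 * t))) :=
    ⟨_, rfl⟩
  rw [← hm₀] at hψS
  have hm₀0 : m₀ 0 = ((2 : ℕ) : ZMod (12 * t)) := by
    rw [hm₀, Pi.neg_apply, Pi.single_eq_same]
    push_cast
    ring
  have hm₀1 : m₀ 1 = 0 := by
    rw [hm₀, Pi.neg_apply, Pi.single_eq_of_ne (by decide : (1 : Fin 2) ≠ 0), neg_zero]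
  have hval : (m₀ 0).valMinAbs = 2 := by
    rw [hm₀0]
    exact_mod_cast ZMod.valMinAbs_natCast_of_le_half (n := 12 * t) (a := 2) (by omega)
  have hm₀ne : m₀ ≠ 0 := by
    intro h0
    have h2 := congrArg (fun m : TorusSite 2 (12 * t) => (m 0).valMinAbs) h0
    simp only [hval, Pi.zero_apply, ZMod.valMinAbs_zero] at h2
    omega
  have hnorm : momentumNormSq (12 * t) m₀ ≤ ε ^ 2 := by
    rw [momentumNormSq_apply, Fin.sum_univ_two, hval, hm₀1, ZMod.valMinAbs_zero]
    push_cast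
    -- `(2π/(12t))² · 4 ≤ ε²` from `4π/ε ≤ t ≤ 12t`
    have h1 : 4 * Real.pi ≤ ε * (12 * t) := by
      rw [div_le_iff₀ hεpos] at htr
      nlinarith [Real.pi_pos, mul_pos htpos hεpos]
    have h2 : 2 * Real.pi / (12 * (t : ℝ)) * 2 ≤ ε := by
      rw [div_mul_eq_mul_div, div_le_iff₀ (by positivity)]
      linarith
    have h3 : 0 ≤ 2 * Real.pi / (12 * (t : ℝ)) * 2 := by positivity
    nlinarith [mul_self_le_mul_self h3 h2]
  -- the window sum is at least its `m₀` term
  have hterm : pairStructureFactor dWaveFormFactor (12 * t) ψ m₀ ≤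
      ∑ m : TorusSite 2 (12 * t), if m ≠ 0 ∧ momentumNormSq (12 * t) m ≤ ε ^ 2 then
        pairStructureFactor dWaveFormFactor (12 * t) ψ m else 0 := by
    have h0 : (if m₀ ≠ 0 ∧ momentumNormSq (12 * t) m₀ ≤ ε ^ 2 then
        pairStructureFactor dWaveFormFactor (12 * t) ψ m₀ else 0) =
          pairStructureFactor dWaveFormFactor (12 * t) ψ m₀ := if_pos ⟨hm₀ne, hnorm⟩
    rw [← h0]
    exact Finset.single_le_sum (f := fun m => if m ≠ 0 ∧ momentumNormSq (12 * t) m ≤ ε ^ 2 then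
        pairStructureFactor dWaveFormFactor (12 * t) ψ m else 0)
      (fun m _ => by
        split_ifs
        · exact pairStructureFactor_nonneg _ _ _ _
        · exact le_rfl)
      (Finset.mem_univ _)
  -- contradiction: `t²/8 ≤ S(m₀) ≤ T_ε ≤ C ε (12t)² < t²/8`
  have hup : C * ε * (((12 * t : ℕ)) : ℝ) ^ 2 < (t : ℝ) ^ 2 / 8 := by
    push_cast
    have h1 : C * ε < 1 / 1152 := by nlinarith
    have h144 : (0 : ℝ) < 144 * (t : ℝ) ^ 2 := by positivity
    nlinarith [mul_lt_mul_of_pos_right h1 h144]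
  linarith [hψS, hterm, hmain, hup]

end Summit.HubbardSuperconductivity.HubbardSuperconductivity.Theorems.WindowInfraredBound.Negative
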